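import Literature.NumberTheory.Automorphic.IntegralWeightHeckeModuleGL2
import HarnessLib

/-!
# Torsion Hecke support: `𝔪_ρ̄ ∈ Supp_{𝕋^S} H^*(X_K, 𝒱)` for `GL_n` over a number field

Topic `NumberTheory/Automorphic` (definition request `defn-TorsionHeckeSupport`, route
`Langlands/TameTypeSwitch`, crux `TypedWitnessFLLifting`); namespace `Literature.NumberTheory.Automorphic`,
generic part under the existing grouping namespace `LevelAction` ("coefficients at `p`", the construction
of `IntegralWeightHeckeModuleGL2`), `GL_n` part under the existing `BigHeckeGLn`; headline predicate
`Literature.NumberTheory.Automorphic.TorsionHeckeSupport`.  Definitions with bodies and proved API only: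
no named fact, no axiom, no `sorry`.

## What is defined

Let `ι : Γ →* 𝒢` (`GL_n(F) → GL_n(𝔸_F^∞)`), `Δ ≤ 𝒢` a submonoid, `τ : Δ →* End_R V` an `R`-linear action on
the coefficients (an `R[Δ]`-module `V`: the "coefficient system carried by the level", e.g. an `𝒪[K_S]`-module
extended trivially along `G(𝔸_F^{∞,S})` [cite: AllenCalegariCaraianiGeeEtAl2023, §2.1.2]), and `U ≤ 𝒢` a level
with `U ⊆ Δ`.  The tree's `LevelAction.cohomology ι Δ τ U i = H^i(Γ, M(U, τ)) = H^i(X_U, 𝒱)` and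
`LevelAction.heckeCohomology` (the double coset `[U α U]`, `α ∈ Δ`, acting in degree `i`) give:

* `LevelAction.heckeGraded ι Δ τ U hU α` — the operator `[UαU]` on the GRADED module `H^*(X_U, 𝒱) = (H^i)_i`, an
  element of `∏_i End_R H^i` (junk `0` off `Δ`);
* `LevelAction.heckeAlgebra ι Δ τ U hU t = 𝕋(U, 𝒱; t)` — for a family `t : I → 𝒢` of Hecke elements, the
  `R`-subalgebra of `∏_i End_R H^i(X_U, 𝒱)` generated by the `[U t_x U]`: the faithfully acting Hecke algebra
  "`𝕋^S(K, 𝒱)` = image of the abstract Hecke algebra `𝕋^S` in the endomorphisms of the cohomology"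
  [cite: AllenCalegariCaraianiGeeEtAl2023, §2.2.1] (there in `End_{D(𝒪)}(RΓ(X_K, 𝒱))`; the map from that algebra
  to ours is surjective with nilpotent kernel — an endomorphism of a bounded complex that kills all cohomology
  groups is nilpotent — so the two have the same prime and maximal ideals: same SUPPORT),
  with generators `LevelAction.heckeGen`;
* `LevelAction.InSupport ι Δ τ U hU t k a` — **the eigencharacter `t_x ↦ a x` (values in an `R`-algebra `k`) is in
  the support of `H^*(X_U, 𝒱)`**: it extends to an `R`-algebra homomorphism `ψ : 𝕋(U, 𝒱; t) → k` with
  `ψ [U t_x U] = a x`.  For a field `k` finite over the residue field this says exactly that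
  `𝔪 := ker ψ` is a maximal ideal of `𝕋(U, 𝒱; t)`, i.e. a maximal ideal of the abstract Hecke algebra containing
  the annihilator of `H^*` — "`𝔪` is in the support of `H^*(X_K, 𝒱)`" [cite: AllenCalegariCaraianiGeeEtAl2023,
  §2.3.2 (remark after the Definition of Galois type)] — with prescribed residual eigenvalues.  PROVED:
  restriction to sub-families (`InSupport.comp`), change of values/target (`congr`, `map`), and the converse
  sanity statement that a non-zero simultaneous EIGENCLASS in some `H^{i₀}(X_U, 𝒱)` over a field puts its
  eigencharacter in the support (`InSupport.of_eigenclass`).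
* For `GL_n` over a number field `F` (`BigHeckeGLn`: `𝒢 = GL_n(𝔸_F^∞)`, `ι = globalEmbedding`, spherical elements
  `t_{v,j} = heckeElement n F v j = diag(ϖ_v,…,ϖ_v,1,…,1)`, `j` entries `ϖ_v`, i.e. ACC+'s `T_{v,j}`
  [cite: AllenCalegariCaraianiGeeEtAl2023, §2.2.2]): `BigHeckeGLn.SphericalIndex n F S` (pairs `(v, j)`, `v ∉ S`,
  `1 ≤ j ≤ n`), `BigHeckeGLn.sphericalElement`, `BigHeckeGLn.sphericalHeckeAlgebra = 𝕋^S(K, 𝒱)`, and the headline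
  **`TorsionHeckeSupport n F S K Δ hK τ ρ̄`**: there is an eigencharacter `a : v ↦ j ↦ a_{v,j}` of `𝕋^S(K, 𝒱)` in the
  support of `H^*(X_K, 𝒱)` with which `ρ̄` is ASSOCIATED in the tree's sense `BigHeckeGLn.IsAssociatedFamily`
  (`ρ̄` unramified at `v ∉ S` with `charpoly ρ̄(Frob_v) = P_v = X^n − a_{v,1}X^{n−1} + … + (−1)^j q_v^{j(j−1)/2}
  a_{v,j} X^{n−j} + …`, `heckeFrobPoly`, the `P_v` of [cite: AllenCalegariCaraianiGeeEtAl2023, §2.2.2]) — i.e.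
  "`ρ̄ ≅ ρ̄_𝔪` for a maximal ideal `𝔪 ⊂ 𝕋^S` in the support of `H^*(X_K, 𝒱)`", the hypothesis under which
  [cite: AllenCalegariCaraianiGeeEtAl2023, §2.3.2] and [cite: Scholze2015, §V.4 (𝕋_{F,S}(K, ξ, i, m))] operate;
  `TorsionHeckeSupport.mono` (enlarging `S`).

## Conventions

* Coefficients at `p`: `V` is a module over the MONOID `Δ ⊇ K`, which must contain the spherical elements
  `t_{v,j}`, `v ∉ S` (they act on `V` through their `S`-components, i.e. trivially); for an `𝒪[K_S]`-module (an
  algebraic weight lattice `𝒱_λ`, a `K_p`-type `σ(τ)`, a Serre weight `F(μ)`) take `Δ = Δ_S · GL_n(𝔸_F^{∞,S})` with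
  `Δ_S ⊇ K_S` and `τ(δ) = δ_S ·`; the tree's `IntegralWeight.heckeMonoid / coeffAction` is the `GL₂` instance.
  Torsion coefficients (`𝒪/ϖ^m`-modules) are allowed: nothing is inverted and `H^*` is not replaced by its
  torsion-free quotient — this is the point of the notion.
* The Hecke algebra is generated by the `T_{v,j}`, `1 ≤ j ≤ n`, without adjoining `T_{v,n}⁻¹`: `T_{v,n} = [K ϖ_v K]`
  acts invertibly on `H^*`, the subalgebra with `T_{v,n}⁻¹` adjoined is its localisation, and characters `ψ` with
  `ψ(T_{v,n}) ∈ kˣ` — automatic for characters associated with a `ρ̄` when `q_v ∈ kˣ` — extend uniquely; so the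
  support condition is unchanged.
* Universe: Mathlib's group cohomology forces `R`, `Γ`, `𝒢`, `V` into one universe (`Type` for `GL_n / F`).
* NOT here: the comparison of `LevelAction.cohomology` for `τ = 1` with `ArithmeticQuotient.cohomology`
  (`sectionsEquivLevelFunctions` gives the coefficient isomorphism) and hence of `TorsionHeckeSupport` with trivial
  coefficients with `HeckeEigenvaluesOccurGL`/`TameLevel.IsAssociated`; localised Hecke algebras `𝕋^S(K, 𝒱)_𝔪`;
  Shapiro / long exact sequences in `𝒱` (functoriality facts requested by the route are theorems to be proved on
  these definitions, not axioms).

## References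

* P. B. Allen, F. Calegari, A. Caraiani, T. Gee, D. Helm, B. V. Le Hung, J. Newton, P. Scholze, R. Taylor,
  J. A. Thorne, *Potential automorphy over CM fields*, Ann. of Math. 197 (2023) = arXiv:1812.09999: §2.1.2
  (coefficient systems, `R[G(F) × K_S]`-modules), §2.1.3 (Hecke algebra of a monoid), §2.2.1 (`𝕋^S(K, 𝒱)` as the
  image in `End(RΓ(X_K, 𝒱))`), §2.2.2 (`T_{v,j}`, `P_v`), §2.3.2 (maximal ideals in the support; Galois type,
  non-Eisenstein). [AllenCalegariCaraianiGeeEtAl2023]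
* P. Scholze, *On torsion in the cohomology of locally symmetric varieties*, Ann. of Math. 182 (2015), §V.4.
  [Scholze2015]
* J. Newton, J. A. Thorne, *Torsion Galois representations over CM fields and Hecke algebras in the derived
  category*, Forum Math. Sigma 4 (2016), §2.2.1. [NewtonThorne2016]
-/

noncomputable section

open scoped NumberField
open IsDedekindDomain

universe u

namespace Literature.NumberTheory.Automorphic

namespace LevelAction

section HeckeAlgebra

variable {R : Type u} [CommRing R] {Γ 𝒢 : Type u} [Group Γ] [Group 𝒢] (ι : Γ →* 𝒢)
  (Δ : Submonoid 𝒢) {V : Type u} [AddCommGroup V] [Module R V] (τ : Δ →* Module.End R V)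
  (U : Subgroup 𝒢) (hU : U.toSubmonoid ≤ Δ)

open scoped Classical in
/-- The Hecke operator `[UαU]` on the GRADED cohomology `H^*(X_U, 𝒱) = (H^i(U, τ))_i`: the family, over all
degrees `i`, of the tree's `heckeCohomology` (junk value `0` for `α ∉ Δ`; every use is at `α ∈ Δ`).
[cite: AllenCalegariCaraianiGeeEtAl2023, §2.1.2–§2.1.3] -/
def heckeGraded (α : 𝒢) : ∀ i : ℕ, Module.End R (cohomology ι Δ τ U i) :=
  fun i => if hα : α ∈ Δ then heckeCohomology ι Δ τ U hU hα i else 0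

/-- On `Δ`, `heckeGraded` is `heckeCohomology` degreewise. [folklore] -/
theorem heckeGraded_apply_of_mem {α : 𝒢} (hα : α ∈ Δ) (i : ℕ) :
    heckeGraded ι Δ τ U hU α i = heckeCohomology ι Δ τ U hU hα i := by
  simp [heckeGraded, hα]

/-- Off `Δ`, `heckeGraded` is the documented junk value `0`. [folklore] -/
theorem heckeGraded_of_not_mem {α : 𝒢} (hα : α ∉ Δ) : heckeGraded ι Δ τ U hU α = 0 := by
  funext i
  simp [heckeGraded, hα]

variable {I : Type*} (t : I → 𝒢)

/-- **The Hecke algebra `𝕋(U, 𝒱; t) ⊆ ∏_i End_R H^i(X_U, 𝒱)`** generated over `R` by the graded double-coset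
operators `[U t_x U]`, `x : I` — the image of the abstract Hecke algebra in the endomorphisms of the (graded)
cohomology, on which it acts faithfully ("`𝕋^S(K, 𝒱)`").
[cite: AllenCalegariCaraianiGeeEtAl2023, §2.2.1] -/
def heckeAlgebra : Subalgebra R (∀ i : ℕ, Module.End R (cohomology ι Δ τ U i)) :=
  Algebra.adjoin R (Set.range fun x : I => heckeGraded ι Δ τ U hU (t x))

/-- The generator `T_x = [U t_x U] ∈ 𝕋(U, 𝒱; t)`. [cite: AllenCalegariCaraianiGeeEtAl2023, §2.2.1–§2.2.2] -/
def heckeGen (x : I) : heckeAlgebra ι Δ τ U hU t :=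
  ⟨heckeGraded ι Δ τ U hU (t x), Algebra.subset_adjoin ⟨x, rfl⟩⟩

/-- Unfolding lemma for `heckeGen`. [folklore] -/
@[simp]
theorem coe_heckeGen (x : I) :
    (heckeGen ι Δ τ U hU t x : ∀ i : ℕ, Module.End R (cohomology ι Δ τ U i)) =
      heckeGraded ι Δ τ U hU (t x) :=
  rfl

/-- **The eigencharacter `T_x ↦ a x` is in the SUPPORT of `H^*(X_U, 𝒱)`**: it extends to an `R`-algebra
homomorphism `ψ : 𝕋(U, 𝒱; t) → k`, `ψ(T_x) = a x` — equivalently (`k` a field finite over the residue field)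
`ker ψ` is a maximal ideal of the faithful Hecke algebra `𝕋(U, 𝒱; t)`, i.e. a maximal ideal of the abstract Hecke
algebra in the support of `H^*(X_U, 𝒱)`, with prescribed residual eigenvalues.  Such a `ψ` is unique.
[cite: AllenCalegariCaraianiGeeEtAl2023, §2.3.2 (maximal ideals of 𝕋^S in the support of H^*(X_K, 𝒱))] -/
def InSupport (k : Type*) [CommRing k] [Algebra R k] (a : I → k) : Prop :=
  ∃ ψ : heckeAlgebra ι Δ τ U hU t →ₐ[R] k, ∀ x : I, ψ (heckeGen ι Δ τ U hU t x) = a x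

variable {ι Δ τ U hU t}

/-- Support only depends on the prescribed values. [folklore] -/
theorem InSupport.congr {k : Type*} [CommRing k] [Algebra R k] {a b : I → k} (hab : ∀ x, a x = b x)
    (h : InSupport ι Δ τ U hU t k a) : InSupport ι Δ τ U hU t k b := by
  obtain ⟨ψ, hψ⟩ := h
  exact ⟨ψ, fun x => (hψ x).trans (hab x)⟩

/-- Support is preserved by extension of the target along an `R`-algebra homomorphism. [folklore] -/
theorem InSupport.map {k k' : Type*} [CommRing k] [Algebra R k] [CommRing k'] [Algebra R k']
    (φ : k →ₐ[R] k') {a : I → k} (h : InSupport ι Δ τ U hU t k a) :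
    InSupport ι Δ τ U hU t k' (fun x => φ (a x)) := by
  obtain ⟨ψ, hψ⟩ := h
  exact ⟨φ.comp ψ, fun x => by rw [AlgHom.comp_apply, hψ]⟩

/-- **Restriction to a sub-family of Hecke elements** (fewer generators, e.g. enlarging `S`): if `T_x ↦ a x` is in
the support for the family `t`, then so is `T_{f y} ↦ a (f y)` for the family `t ∘ f`. [folklore] -/
theorem InSupport.comp {k : Type*} [CommRing k] [Algebra R k] {a : I → k} (h : InSupport ι Δ τ U hU t k a)
    {J : Type*} (f : J → I) : InSupport ι Δ τ U hU (t ∘ f) k (a ∘ f) := by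
  obtain ⟨ψ, hψ⟩ := h
  have hle : heckeAlgebra ι Δ τ U hU (t ∘ f) ≤ heckeAlgebra ι Δ τ U hU t :=
    Algebra.adjoin_mono (by
      rintro _ ⟨y, rfl⟩
      exact ⟨f y, rfl⟩)
  refine ⟨ψ.comp (Subalgebra.inclusion hle), fun y => ?_⟩
  have hgen : Subalgebra.inclusion hle (heckeGen ι Δ τ U hU (t ∘ f) y) = heckeGen ι Δ τ U hU t (f y) :=
    Subtype.ext rfl
  rw [AlgHom.comp_apply, hgen, hψ]
  rfl

/-- Every element of `𝕋(U, 𝒱; t)` acts on a simultaneous eigenclass `c ∈ H^{i₀}` of the generators by a scalar.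
[folklore] -/
theorem exists_smul_of_mem_heckeAlgebra {k : Type u} [Field k] {Γ' 𝒢' : Type u} [Group Γ'] [Group 𝒢']
    {ι' : Γ' →* 𝒢'} {Δ' : Submonoid 𝒢'} {V' : Type u} [AddCommGroup V'] [Module k V']
    {τ' : Δ' →* Module.End k V'} {U' : Subgroup 𝒢'} {hU' : U'.toSubmonoid ≤ Δ'} {I' : Type*} {t' : I' → 𝒢'}
    {a : I' → k} {i₀ : ℕ} {c : cohomology ι' Δ' τ' U' i₀}
    (hc : ∀ x, heckeGraded ι' Δ' τ' U' hU' (t' x) i₀ c = a x • c)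
    {s : ∀ i : ℕ, Module.End k (cohomology ι' Δ' τ' U' i)} (hs : s ∈ heckeAlgebra ι' Δ' τ' U' hU' t') :
    ∃ r : k, s i₀ c = r • c := by
  refine Algebra.adjoin_induction (fun _ hg => ?_) (fun r => ⟨r, ?_⟩) (fun _ _ _ _ h₁ h₂ => ?_)
    (fun _ _ _ _ h₁ h₂ => ?_) hs
  · obtain ⟨x, rfl⟩ := hg
    exact ⟨a x, hc x⟩
  · simp [Pi.algebraMap_apply, Module.algebraMap_end_apply]
  · obtain ⟨r₁, h₁⟩ := h₁
    obtain ⟨r₂, h₂⟩ := h₂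
    exact ⟨r₁ + r₂, by rw [Pi.add_apply, LinearMap.add_apply, h₁, h₂, add_smul]⟩
  · obtain ⟨r₁, h₁⟩ := h₁
    obtain ⟨r₂, h₂⟩ := h₂
    exact ⟨r₂ * r₁, by rw [Pi.mul_apply, Module.End.mul_apply, h₂, map_smul, h₁, smul_smul]⟩

/-- **Eigenclasses witness support.**  Over a field `k` of coefficients: if some `H^{i₀}(X_U, 𝒱)` contains a
NON-ZERO simultaneous eigenclass `c` of the operators `[U t_x U]` with eigenvalues `a x`, then the eigencharacter
`T_x ↦ a x` is in the support of `H^*(X_U, 𝒱)` (every Hecke operator acts on `c` by a unique scalar, which defines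
the character).  The converse holds after a finite extension of `k` (not formalised). [folklore] -/
theorem InSupport.of_eigenclass {k : Type u} [Field k] {Γ' 𝒢' : Type u} [Group Γ'] [Group 𝒢']
    {ι' : Γ' →* 𝒢'} {Δ' : Submonoid 𝒢'} {V' : Type u} [AddCommGroup V'] [Module k V']
    {τ' : Δ' →* Module.End k V'} {U' : Subgroup 𝒢'} {hU' : U'.toSubmonoid ≤ Δ'} {I' : Type*} {t' : I' → 𝒢'}
    {a : I' → k} {i₀ : ℕ} {c : cohomology ι' Δ' τ' U' i₀} (hc0 : c ≠ 0)
    (hc : ∀ x, heckeGraded ι' Δ' τ' U' hU' (t' x) i₀ c = a x • c) :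
    InSupport ι' Δ' τ' U' hU' t' k a := by
  -- the scalar by which `s ∈ 𝕋` acts on `c`, and its uniqueness
  have huniq : ∀ {r r' : k}, r • c = r' • c → r = r' := fun h => smul_left_injective k hc0 h
  let φ : heckeAlgebra ι' Δ' τ' U' hU' t' → k := fun s =>
    Classical.choose (exists_smul_of_mem_heckeAlgebra hc s.2)
  have hφ : ∀ s : heckeAlgebra ι' Δ' τ' U' hU' t',
      (s : ∀ i : ℕ, Module.End k (cohomology ι' Δ' τ' U' i)) i₀ c = φ s • c := fun s =>
    Classical.choose_spec (exists_smul_of_mem_heckeAlgebra hc s.2)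
  have hkey : ∀ (s : heckeAlgebra ι' Δ' τ' U' hU' t') (r : k),
      (s : ∀ i : ℕ, Module.End k (cohomology ι' Δ' τ' U' i)) i₀ c = r • c → φ s = r :=
    fun s r h => huniq ((hφ s).symm.trans h)
  let ψ : heckeAlgebra ι' Δ' τ' U' hU' t' →ₐ[k] k :=
    { toFun := φ
      map_one' := hkey 1 1 (by simp)
      map_mul' := fun s₁ s₂ => hkey (s₁ * s₂) _ (by
        rw [Subalgebra.coe_mul, Pi.mul_apply, Module.End.mul_apply, hφ s₂, map_smul, hφ s₁, smul_smul,
          mul_comm])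
      map_zero' := hkey 0 0 (by simp)
      map_add' := fun s₁ s₂ => hkey (s₁ + s₂) _ (by
        rw [Subalgebra.coe_add, Pi.add_apply, LinearMap.add_apply, hφ s₁, hφ s₂, add_smul])
      commutes' := fun r => hkey _ r (by
        simp [Subalgebra.coe_algebraMap, Pi.algebraMap_apply, Module.algebraMap_end_apply]) }
  exact ⟨ψ, fun x => hkey _ _ (hc x)⟩

end HeckeAlgebra

end LevelAction

/-! ### `GL_n` over a number field: the spherical Hecke algebra `𝕋^S(K, 𝒱)` and `TorsionHeckeSupport` -/

namespace BigHeckeGLn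

variable (n : ℕ) (F : Type) [Field F] [NumberField F]

/-- The index set of the SPHERICAL generators away from `S`: pairs `(v, j)` with `v ∉ S` a finite place and
`1 ≤ j ≤ n`. [cite: AllenCalegariCaraianiGeeEtAl2023, §2.2.2] -/
def SphericalIndex (S : Set (HeightOneSpectrum (𝓞 F))) : Type :=
  {p : HeightOneSpectrum (𝓞 F) × ℕ // p.1 ∉ S ∧ 1 ≤ p.2 ∧ p.2 ≤ n}

/-- The spherical Hecke element `t_{v,j} = diag(ϖ_v,…,ϖ_v,1,…,1)` (`j` entries `ϖ_v`) at an index `(v, j)`, whose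
`GL_n(𝒪_v)`-double coset is `T_{v,j}` (the tree's `heckeElement`). [cite: AllenCalegariCaraianiGeeEtAl2023, §2.2.2] -/
def sphericalElement (S : Set (HeightOneSpectrum (𝓞 F))) : SphericalIndex n F S → FiniteAdelicGL n F :=
  fun x => heckeElement n F x.1.1 x.1.2

/-- Enlarging `S` shrinks the index set. [folklore] -/
def SphericalIndex.inclusion {S S' : Set (HeightOneSpectrum (𝓞 F))} (h : S ⊆ S') :
    SphericalIndex n F S' → SphericalIndex n F S :=
  fun x => ⟨x.1, fun hx => x.2.1 (h hx), x.2.2⟩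

/-- `sphericalElement` is compatible with the inclusion of index sets. [folklore] -/
@[simp]
theorem sphericalElement_inclusion {S S' : Set (HeightOneSpectrum (𝓞 F))} (h : S ⊆ S')
    (x : SphericalIndex n F S') :
    sphericalElement n F S (SphericalIndex.inclusion n F h x) = sphericalElement n F S' x :=
  rfl

variable {𝒪 : Type} [CommRing 𝒪]

/-- **The spherical Hecke algebra `𝕋^S(K, 𝒱) ⊆ ∏_i End_𝒪 H^i(X_K, 𝒱)`** of `GL_n / F` at level `K ⊆ Δ` with
coefficient system `τ : Δ →* End_𝒪 V` ("coefficients at `p`"): generated by the `T_{v,j}`, `v ∉ S`, `1 ≤ j ≤ n`,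
acting on `H^i(X_K, 𝒱) = LevelAction.cohomology (globalEmbedding n F) Δ τ K i`.
[cite: AllenCalegariCaraianiGeeEtAl2023, §2.2.1] -/
abbrev sphericalHeckeAlgebra (S : Set (HeightOneSpectrum (𝓞 F))) (K : Subgroup (FiniteAdelicGL n F))
    (Δ : Submonoid (FiniteAdelicGL n F)) (hK : K.toSubmonoid ≤ Δ) {V : Type} [AddCommGroup V] [Module 𝒪 V]
    (τ : Δ →* Module.End 𝒪 V) :
    Subalgebra 𝒪 (∀ i : ℕ, Module.End 𝒪 (LevelAction.cohomology (globalEmbedding n F) Δ τ K i)) :=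
  LevelAction.heckeAlgebra (globalEmbedding n F) Δ τ K hK (sphericalElement n F S)

end BigHeckeGLn

open BigHeckeGLn in
/-- **Torsion Hecke support: `𝔪_ρ̄` is in the support of `H^*(X_K, 𝒱)`.**  For `GL_n` over the number field `F`,
a set `S` of finite places (the bad ones: `⊇` places above `p` and where `K` or `ρ̄` ramify), a level
`K ≤ GL_n(𝔸_F^∞)` contained in a monoid `Δ` carrying the coefficient system `τ : Δ →* End_𝒪 V` (an `𝒪[K_S]`-module
`𝒱` — algebraic weight lattice `𝒱_λ`, `K_p`-type `σ(τ)`, Serre weight `F(μ)`, torsion allowed — extended trivially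
along `GL_n(𝔸_F^{∞,S})`, so that `Δ ∋ t_{v,j}` for `v ∉ S`), and `ρ̄ : Γ_F → GL_n(k)` continuous with `k` a
topological `𝒪`-algebra (the residue field, or `𝒪/ϖ^m`): there is an eigencharacter `a = (a_{v,j})_{v ∉ S, 1≤j≤n}`
of the spherical Hecke algebra `𝕋^S(K, 𝒱)` IN THE SUPPORT of `H^*(X_K, 𝒱) = ⊕_i H^i(GL_n(F), M(K, τ))`
(`LevelAction.InSupport`: an `𝒪`-algebra map `ψ : 𝕋^S(K, 𝒱) → k`, `ψ(T_{v,j}) = a_{v,j}`; `ker ψ = 𝔪`) with which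
`ρ̄` is associated (`IsAssociatedFamily`: `ρ̄` unramified at every `v ∉ S` with
`charpoly ρ̄(Frob_v) = P_v = X^n − a_{v,1}X^{n−1} + … + (−1)^j q_v^{j(j−1)/2} a_{v,j} X^{n−j} + …`), i.e. `ρ̄ = ρ̄_𝔪` for
a maximal ideal `𝔪` of `𝕋^S` in the support of `H^*(X_K, 𝒱)`.
[cite: AllenCalegariCaraianiGeeEtAl2023, §2.3.2 (Definition: Galois type) and §2.2.1–§2.2.2] -/
def TorsionHeckeSupport (n : ℕ) (F : Type) [Field F] [NumberField F] {𝒪 : Type} [CommRing 𝒪]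
    (S : Set (HeightOneSpectrum (𝓞 F))) (K : Subgroup (FiniteAdelicGL n F))
    (Δ : Submonoid (FiniteAdelicGL n F)) (hK : K.toSubmonoid ≤ Δ) {V : Type} [AddCommGroup V] [Module 𝒪 V]
    (τ : Δ →* Module.End 𝒪 V) {k : Type*} [CommRing k] [TopologicalSpace k] [Algebra 𝒪 k]
    (ρ : GaloisRepresentations.FramedGaloisRep F k n) : Prop :=
  ∃ a : HeightOneSpectrum (𝓞 F) → ℕ → k,
    LevelAction.InSupport (globalEmbedding n F) Δ τ K hK (sphericalElement n F S) k (fun x => a x.1.1 x.1.2) ∧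
      IsAssociatedFamily n S a ρ

namespace TorsionHeckeSupport

open BigHeckeGLn

variable {n : ℕ} {F : Type} [Field F] [NumberField F] {𝒪 : Type} [CommRing 𝒪]
  {S S' : Set (HeightOneSpectrum (𝓞 F))} {K : Subgroup (FiniteAdelicGL n F)}
  {Δ : Submonoid (FiniteAdelicGL n F)} {hK : K.toSubmonoid ≤ Δ} {V : Type} [AddCommGroup V] [Module 𝒪 V]
  {τ : Δ →* Module.End 𝒪 V} {k : Type*} [CommRing k] [TopologicalSpace k] [Algebra 𝒪 k]
  {ρ : GaloisRepresentations.FramedGaloisRep F k n}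

/-- **Enlarging the bad set**: support away from `S` implies support away from any `S' ⊇ S` (fewer generators,
fewer Frobenius conditions). [folklore] -/
theorem mono (hSS' : S ⊆ S') (h : TorsionHeckeSupport n F S K Δ hK τ ρ) :
    TorsionHeckeSupport n F S' K Δ hK τ ρ := by
  obtain ⟨a, ha, hρ⟩ := h
  refine ⟨a, ?_, fun v hv => hρ v fun hv' => hv (hSS' hv')⟩
  exact ha.comp (SphericalIndex.inclusion n F hSS')

/-- The witnessing eigencharacter: unramifiedness of `ρ̄` away from `S` is part of the notion. [folklore] -/
theorem isUnramifiedAt (h : TorsionHeckeSupport n F S K Δ hK τ ρ) {v : HeightOneSpectrum (𝓞 F)} (hv : v ∉ S) :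
    ρ.IsUnramifiedAt v := by
  obtain ⟨a, -, hρ⟩ := h
  exact (hρ v hv).1

/-- **Eigenclasses witness torsion Hecke support** (field coefficients `𝒪 = k`): a NON-ZERO simultaneous
eigenclass `c ∈ H^{i₀}(X_K, 𝒱)` of the `T_{v,j}`, `v ∉ S`, `1 ≤ j ≤ n`, with eigenvalues `a_{v,j}`, together with
a `ρ̄` associated with `a`, gives `TorsionHeckeSupport` (`LevelAction.InSupport.of_eigenclass`). [folklore] -/
theorem of_eigenclass {k' : Type} [Field k'] [TopologicalSpace k'] {Δ' : Submonoid (FiniteAdelicGL n F)}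
    {hK' : K.toSubmonoid ≤ Δ'} {V' : Type} [AddCommGroup V'] [Module k' V'] {τ' : Δ' →* Module.End k' V'}
    {ρ' : GaloisRepresentations.FramedGaloisRep F k' n} {a : HeightOneSpectrum (𝓞 F) → ℕ → k'} {i₀ : ℕ}
    {c : LevelAction.cohomology (globalEmbedding n F) Δ' τ' K i₀} (hc0 : c ≠ 0)
    (hc : ∀ x : SphericalIndex n F S,
      LevelAction.heckeGraded (globalEmbedding n F) Δ' τ' K hK' (sphericalElement n F S x) i₀ c =
        a x.1.1 x.1.2 • c)
    (hρ : IsAssociatedFamily n S a ρ') : TorsionHeckeSupport n F S K Δ' hK' τ' ρ' :=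
  ⟨a, LevelAction.InSupport.of_eigenclass hc0 hc, hρ⟩

end TorsionHeckeSupport

end Literature.NumberTheory.Automorphic

end
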